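/-
Copyright (c) 2026. All rights reserved.
Released under Apache 2.0 license as described in the file LICENSE.
-/
import Literature.NumberTheory.Automorphic.MaximalOrderDiscThirteenDedekindHasse
import Literature.NumberTheory.Automorphic.BrandtWeightClassFunction
import Literature.NumberTheory.Automorphic.BrandtModuleLocal
import Literature.NumberTheory.Automorphic.BrandtTraceOptimalEmbeddings
import Literature.NumberTheory.Automorphic.QuaternionConjugacy
import HarnessLib

/-!
# The maximal order `O₁₃` of `(−2,−13 ∣ ℚ)` has class number one — THE LAST CASE `D = 13` of Voight's Thm. 25.4.1:
# every invertible right `O₁₃`-ideal is principal (by the Dedekind–Hasse criterion), `# Cls O₁₃ = 1`, `w = 1`, and Eichler's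
# mass at `D = 13` is `Σ 1/w = 1`

[tag: quaternion_algebra] [tag: maximal_order] [tag: class_number] [tag: brandt_matrix]

Topic `NumberTheory/Automorphic`; THEOREMS ONLY (no definition, no named fact, no instance; net Literature debt `0`).
Lane `lit-hodgefound`, seat p12, gen 46 — fourth file on the definite quaternion order of discriminant `13`; the `D = 13` twin of
`MaximalOrderDiscSevenClassNumberOne` (the Dedekind–Hasse step now coming from Minkowski's theorem and four certificates).

Voight Thm. 25.4.1: the maximal order of the definite quaternion algebra of discriminant `D` has `# Cls O = 1` iff
`D ∈ {2, 3, 5, 7, 13}`; with `HurwitzOrder*` (`D = 2`), `MaximalOrderDiscThree*`, `MaximalOrderDiscFive*`, `MaximalOrderDiscSeven*`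
this file completes the direction ⟸ in the tree. Exercise 17.10 (c): for `D = 7, 13` the maximal orders are NOT norm-Euclidean.
Cardoso–Machiavelo (arXiv:2506.22651, Thm. 3 and Thm. 9) prove that the maximal order of discriminant `13` is a (right) PID by
the DEDEKIND–HASSE CRITERION, whose hypothesis the tree proved in `MaximalOrderDiscThirteenDedekindHasse.dedekindHasse`
(`∀ ρ ∉ O₁₃ ∃ γ, β ∈ O₁₃ : 0 < nrd(ργ − β) < 1`). This file runs the criterion ⟹ principal argument (their proof of Thm. 3, ⟸):
an invertible right `O₁₃`-ideal `J` contains a non-zero element `b` of least (scaled) reduced norm; if some `x ∈ J` were not in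
`bO₁₃`, then `ρ := b⁻¹x ∉ O₁₃` and the criterion's `γ, β` give `xγ − bβ = b(ργ − β) ∈ J ∖ 0` of smaller norm — so `J = bO₁₃`,
`Cls O₁₃` is a point, every class has unit index `w = [O₁₃^× : ±1] = 1`, and `Σ_c 1/w_c = 1 = φ(13)/12` (Eichler's mass formula
at `D = 13` — the unique definite maximal order over `ℚ` with mass `1` and one class).

* §1 **`exists_eq_units_smul_of_mem_rightIdeals`** (EVERY INVERTIBLE RIGHT `O₁₃`-IDEAL IS PRINCIPAL, `J = bO₁₃` — Cardoso–Machiavelo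
  Thm. 9 «`H₇,₁₃` is a PID», here for the model inside `(−2,−13 ∣ ℚ)`);
* §2 `lattice_mem_rightIdeals`, `units_smul_mem_rightIdeals`, **`classSet_mk_eq`** ∕ `classSet_eq` (`Cls O₁₃` IS A POINT),
  `subsingleton_classSet`, **`card_classSet`** (`# Cls O₁₃ = 1`, VOIGHT THM. 25.4.1 AT `D = 13`);
* §3 class functions: `card_traceNormSet_units_smul`, `card_normSet_units_smul`, `exists_rep_eq_units_smul`, `card_traceNormSet_rep`,
  **`card_normSet_rep`**, **`weight_eq_one`** (`w_c = 1`), `sum_inv_weight_eq` (`Σ_c 1/w_c = 1 = (13 − 1)/12` — EICHLER'S MASS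
  FORMULA AT `D = 13`).

## Sources

* A. Cardoso, A. Machiavelo, *The Dedekind–Hasse Criterion in Quaternion Algebras*, arXiv:2506.22651 (2025), Thm. 3 (the
  criterion ⟹ every left∕right ideal is principal: «Let γ be an element of the ideal I of minimal norm … the element
  η := αδ − βγ ∈ I ∖ {0} satisfies N(η) < N(γ), which yields the desired contradiction»), §5.2 Thm. 9 («`H₇,₁₃` is a PID»).
  [cite: CardosoMachiavelo2025, Thm. 3 and Thm. 9]
* J. Voight, *Quaternion Algebras*, GTM 288 (2021): Thm. 25.4.1 (`# Cls O = 1 ⟺ D ∈ {2, 3, 5, 7, 13}`; here `D = 13`, ⟸),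
  Exercise 17.10 (a), (c), Thm. 25.1.1 (mass formula `Σ 1/w_J = φ(D)/12 = 12/12`), Def. 17.3.1, Lemma 17.3.3.
  [cite: Voight2021, Thm. 25.4.1 (D = 13); Exercise 17.10; Thm. 25.1.1; Def. 17.3.1]
* M.-F. Vignéras, LNM 800 (1980), Ch. I §4 (classes à droite), Ch. V §2 Cor. 2.3 (formule de masse, here `12/12`), Ch. V §3
  (the ten Eichler orders of class number one). [cite: VignerasLNM800, Ch. I §4; Ch. V §2 Cor. 2.3; Ch. V §3]

## Scope (honest)

Theorems only — no definition, no named fact, no instance. `h = 1` for THIS order; the transport to every Brandt setup of type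
`(1, 13)` is the sequel.
-/

open Quaternion
open scoped Pointwise
open Literature.NumberTheory.Automorphic.Brandt

namespace Literature.NumberTheory.Automorphic.MaxOrderDiscThirteen

/-! ## §1 Every invertible right `O₁₃`-ideal is principal -/

section Principal

/-- Reduced norms of elements of a lattice `I` with `N·I ⊆ O₁₃` become natural numbers after scaling by `N²`. [folklore] -/
private theorem exists_sq_mul_reducedNorm_eq_natCast {x : ℍ[ℚ,-2,-13]} {N : ℕ} (h : (N : ℤ) • x ∈ (Submodule.span ℤ (Set.range ![(⟨1, 0, 0, 0⟩ : ℍ[ℚ,-2,-13]), ⟨0, 1, 0, 0⟩, ⟨1/2, 1/2, 1/2, 0⟩, ⟨-1/2, 1/4, 0, 1/4⟩]))) :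
    ∃ M : ℕ, (N : ℚ) ^ 2 * reducedNorm ℚ ℍ[ℚ,-2,-13] x = M := by
  haveI := isQuaternionAlgebra
  obtain ⟨M, hM⟩ := exists_reducedNorm_eq_natCast_of_mem h
  refine ⟨M, ?_⟩
  rw [← hM, ← Int.cast_smul_eq_zsmul ℚ, Int.cast_natCast, reducedNorm_smul]

/-- **EVERY INVERTIBLE RIGHT `O₁₃`-IDEAL IS PRINCIPAL: `J = bO₁₃`, `b ∈ Bˣ`** (`# Cls O₁₃ = 1`; Cardoso–Machiavelo Thm. 9). Let
`J ∈ rightIdeals O₁₃`; take `α ∈ J ∖ 0` of least scaled norm `N²·nrd(α) ∈ ℕ` (`N·J ⊆ O₁₃`); if `β ∈ J ∖ αO₁₃` then `ρ := α⁻¹β ∉ O₁₃`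
and the Dedekind–Hasse multipliers `a, b ∈ O₁₃` with `0 < nrd(ρa − b) < 1` produce `βa − αb = α(ρa − b) ∈ J ∖ 0` of smaller norm —
contradiction; so `J = αO₁₃`. [cite: CardosoMachiavelo2025, Thm. 3 (⟸) and Thm. 9] [cite: Voight2021, Thm. 25.4.1 (D = 13), Def. 17.3.1] [cite: VignerasLNM800, Ch. I §4 (classes à droite)] -/
theorem exists_eq_units_smul_of_mem_rightIdeals {I : Submodule ℤ ℍ[ℚ,-2,-13]} (hI : I ∈ rightIdeals (Submodule.span ℤ (Set.range ![(⟨1, 0, 0, 0⟩ : ℍ[ℚ,-2,-13]), ⟨0, 1, 0, 0⟩, ⟨1/2, 1/2, 1/2, 0⟩, ⟨-1/2, 1/4, 0, 1/4⟩]))) :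
    ∃ b : (ℍ[ℚ,-2,-13])ˣ, I = b • (Submodule.span ℤ (Set.range ![(⟨1, 0, 0, 0⟩ : ℍ[ℚ,-2,-13]), ⟨0, 1, 0, 0⟩, ⟨1/2, 1/2, 1/2, 0⟩, ⟨-1/2, 1/4, 0, 1/4⟩])) := by
  classical
  haveI := isQuaternionAlgebra
  obtain ⟨hfull, hright, -⟩ := hI
  have hmul : ∀ x ∈ I, ∀ g ∈ (Submodule.span ℤ (Set.range ![(⟨1, 0, 0, 0⟩ : ℍ[ℚ,-2,-13]), ⟨0, 1, 0, 0⟩, ⟨1/2, 1/2, 1/2, 0⟩, ⟨-1/2, 1/4, 0, 1/4⟩])), x * g ∈ I := by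
    intro x hx g hg
    have hg' : g ∈ rightOrder I := by rw [hright]; exact hg
    exact hg' x hx
  -- bounded denominators: `N • I ⊆ O₇`
  obtain ⟨N, hN0, hN⟩ := exists_nat_smul_mem_of_fg isFullLattice_lattice hfull.1
  have hNpos : 0 < N := Nat.pos_of_ne_zero hN0
  -- a non-zero element
  have hne : ∃ x ∈ I, x ≠ 0 := by
    obtain ⟨n, hn0, hn⟩ := hfull.2 1
    refine ⟨_, hn, fun h => hn0 ?_⟩
    have h' := congrArg QuaternionAlgebra.re h
    rw [← Int.cast_smul_eq_zsmul ℚ, QuaternionAlgebra.re_smul, smul_eq_mul] at h'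
    simp only [QuaternionAlgebra.re_one, mul_one, QuaternionAlgebra.re_zero] at h'
    exact_mod_cast h'
  -- the scaled norm `ν(x) = N² nrd(x) ∈ ℕ` on `I`
  have hint : ∀ x ∈ I, ∃ M : ℕ, (N : ℚ) ^ 2 * reducedNorm ℚ ℍ[ℚ,-2,-13] x = M := fun x hx =>
    exists_sq_mul_reducedNorm_eq_natCast (hN x hx)
  let P : ℕ → Prop := fun n => ∃ x ∈ I, x ≠ 0 ∧ (N : ℚ) ^ 2 * reducedNorm ℚ ℍ[ℚ,-2,-13] x = n
  have hP : ∃ n, P n := by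
    obtain ⟨x, hx, hx0⟩ := hne
    obtain ⟨n, hn⟩ := hint x hx
    exact ⟨n, x, hx, hx0, hn⟩
  obtain ⟨α, hαI, hα0, hαn⟩ : P (Nat.find hP) := Nat.find_spec hP
  have hmin : ∀ n, P n → Nat.find hP ≤ n := fun n h => Nat.find_min' hP h
  obtain ⟨u, hu⟩ := forall_isUnit α hα0
  have hαpos : 0 < (N : ℚ) ^ 2 * reducedNorm ℚ ℍ[ℚ,-2,-13] α := by
    have h1 : 0 < reducedNorm ℚ ℍ[ℚ,-2,-13] α :=
      QuaternionAlgebra.reducedNorm_pos (a := -2) (b := -13) (by norm_num) (by norm_num) hα0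
    positivity
  refine ⟨u, le_antisymm (fun β hβ => ?_) fun β hβ => ?_⟩
  · -- the Dedekind–Hasse step: `β ∈ αO₇`
    by_contra hβu
    have hρ : ((u⁻¹ : (ℍ[ℚ,-2,-13])ˣ) : ℍ[ℚ,-2,-13]) * β ∉ (Submodule.span ℤ (Set.range ![(⟨1, 0, 0, 0⟩ : ℍ[ℚ,-2,-13]), ⟨0, 1, 0, 0⟩, ⟨1/2, 1/2, 1/2, 0⟩, ⟨-1/2, 1/4, 0, 1/4⟩])) := by
      intro hmem
      apply hβu
      rw [mem_units_smul_submodule_iff, Units.smul_def, smul_eq_mul]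
      exact hmem
    obtain ⟨a, ha, b, hb, h1, h2⟩ := dedekindHasse hρ
    have hγI : β * a - α * b ∈ I := I.sub_mem (hmul β hβ a ha) (hmul α hαI b hb)
    have hfac : β * a - α * b = α * (((u⁻¹ : (ℍ[ℚ,-2,-13])ˣ) : ℍ[ℚ,-2,-13]) * β * a - b) := by
      rw [mul_sub, ← mul_assoc, ← mul_assoc, ← hu, Units.mul_inv, one_mul]
    have hnorm : reducedNorm ℚ ℍ[ℚ,-2,-13] (β * a - α * b) =
        reducedNorm ℚ ℍ[ℚ,-2,-13] α * reducedNorm ℚ ℍ[ℚ,-2,-13] (((u⁻¹ : (ℍ[ℚ,-2,-13])ˣ) : ℍ[ℚ,-2,-13]) * β * a - b) := by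
      rw [hfac, reducedNorm_mul_holds ℚ ℍ[ℚ,-2,-13]]
    have hrlt : (N : ℚ) ^ 2 * reducedNorm ℚ ℍ[ℚ,-2,-13] (β * a - α * b) < (N : ℚ) ^ 2 * reducedNorm ℚ ℍ[ℚ,-2,-13] α := by
      rw [hnorm, ← mul_assoc]
      calc (N : ℚ) ^ 2 * reducedNorm ℚ ℍ[ℚ,-2,-13] α * reducedNorm ℚ ℍ[ℚ,-2,-13] (((u⁻¹ : (ℍ[ℚ,-2,-13])ˣ) : ℍ[ℚ,-2,-13]) * β * a - b)
          < (N : ℚ) ^ 2 * reducedNorm ℚ ℍ[ℚ,-2,-13] α * 1 := mul_lt_mul_of_pos_left h2 hαpos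
        _ = (N : ℚ) ^ 2 * reducedNorm ℚ ℍ[ℚ,-2,-13] α := mul_one _
    have hrpos : 0 < (N : ℚ) ^ 2 * reducedNorm ℚ ℍ[ℚ,-2,-13] (β * a - α * b) := by
      rw [hnorm, ← mul_assoc]
      exact mul_pos hαpos h1
    have hr0 : β * a - α * b ≠ 0 := by
      intro h0
      rw [h0, reducedNorm_eq] at hrpos
      simp at hrpos
    obtain ⟨n, hn⟩ := hint _ hγI
    have hle := hmin n ⟨_, hγI, hr0, hn⟩
    have hle' : (N : ℚ) ^ 2 * reducedNorm ℚ ℍ[ℚ,-2,-13] α ≤ (N : ℚ) ^ 2 * reducedNorm ℚ ℍ[ℚ,-2,-13] (β * a - α * b) := by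
      rw [hαn, hn]; exact_mod_cast hle
    exact absurd hrlt (not_lt.mpr hle')
  · -- `uO₇ ⊆ I`
    rw [mem_units_smul_submodule_iff, Units.smul_def, smul_eq_mul] at hβ
    have e : β = α * (((u⁻¹ : (ℍ[ℚ,-2,-13])ˣ) : ℍ[ℚ,-2,-13]) * β) := by rw [← hu, ← mul_assoc, Units.mul_inv, one_mul]
    rw [e]
    exact hmul α hαI _ hβ

end Principal

/-! ## §2 `Cls O₁₃` is a point -/

section Classes

/-- **`O₁₃` is an invertible right `O₁₃`-ideal** (the trivial class). [cite: VignerasLNM800, Ch. I §4 (idéaux)] -/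
theorem lattice_mem_rightIdeals : (Submodule.span ℤ (Set.range ![(⟨1, 0, 0, 0⟩ : ℍ[ℚ,-2,-13]), ⟨0, 1, 0, 0⟩, ⟨1/2, 1/2, 1/2, 0⟩, ⟨-1/2, 1/4, 0, 1/4⟩])) ∈ rightIdeals (Submodule.span ℤ (Set.range ![(⟨1, 0, 0, 0⟩ : ℍ[ℚ,-2,-13]), ⟨0, 1, 0, 0⟩, ⟨1/2, 1/2, 1/2, 0⟩, ⟨-1/2, 1/4, 0, 1/4⟩])) := by
  haveI := isQuaternionAlgebra
  haveI : IsAddTorsionFree ℍ[ℚ,-2,-13] := isAddTorsionFree_of_charZero_module ℚ ℍ[ℚ,-2,-13]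
  exact mem_rightIdeals_of_isInvertibleRightIdeal forall_isUnit isZOrder_lattice
    isZOrder_lattice.isInvertibleRightIdeal_self

/-- Translates `βJ` of invertible right `O₁₃`-ideals are invertible right `O₁₃`-ideals. [cite: VignerasLNM800, Ch. I §4 Lemme 4.3] -/
theorem units_smul_mem_rightIdeals {I : Submodule ℤ ℍ[ℚ,-2,-13]} (hI : I ∈ rightIdeals (Submodule.span ℤ (Set.range ![(⟨1, 0, 0, 0⟩ : ℍ[ℚ,-2,-13]), ⟨0, 1, 0, 0⟩, ⟨1/2, 1/2, 1/2, 0⟩, ⟨-1/2, 1/4, 0, 1/4⟩]))) (β : (ℍ[ℚ,-2,-13])ˣ) :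
    β • I ∈ rightIdeals (Submodule.span ℤ (Set.range ![(⟨1, 0, 0, 0⟩ : ℍ[ℚ,-2,-13]), ⟨0, 1, 0, 0⟩, ⟨1/2, 1/2, 1/2, 0⟩, ⟨-1/2, 1/4, 0, 1/4⟩])) := by
  haveI := isQuaternionAlgebra
  haveI : IsAddTorsionFree ℍ[ℚ,-2,-13] := isAddTorsionFree_of_charZero_module ℚ ℍ[ℚ,-2,-13]
  rw [rightIdeals_eq_invertibleRightIdeals forall_isUnit isZOrder_lattice] at hI ⊢
  exact IsInvertibleRightIdeal.units_smul β hI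

/-- **`Cls O₁₃` IS A POINT: `[J] = [O₁₃]` for every invertible right `O₁₃`-ideal `J`** (`# Cls O₁₃ = 1`, Voight Thm. 25.4.1 at
`D = 13`). [cite: Voight2021, Thm. 25.4.1 (D = 13) and Exercise 17.10] [cite: VignerasLNM800, Ch. I §4 (classes à droite)] -/
theorem classSet_mk_eq (I : rightIdeals (Submodule.span ℤ (Set.range ![(⟨1, 0, 0, 0⟩ : ℍ[ℚ,-2,-13]), ⟨0, 1, 0, 0⟩, ⟨1/2, 1/2, 1/2, 0⟩, ⟨-1/2, 1/4, 0, 1/4⟩]))) :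
    Quotient.mk (rightClassSetoid (Submodule.span ℤ (Set.range ![(⟨1, 0, 0, 0⟩ : ℍ[ℚ,-2,-13]), ⟨0, 1, 0, 0⟩, ⟨1/2, 1/2, 1/2, 0⟩, ⟨-1/2, 1/4, 0, 1/4⟩]))) I = Quotient.mk (rightClassSetoid (Submodule.span ℤ (Set.range ![(⟨1, 0, 0, 0⟩ : ℍ[ℚ,-2,-13]), ⟨0, 1, 0, 0⟩, ⟨1/2, 1/2, 1/2, 0⟩, ⟨-1/2, 1/4, 0, 1/4⟩]))) ⟨(Submodule.span ℤ (Set.range ![(⟨1, 0, 0, 0⟩ : ℍ[ℚ,-2,-13]), ⟨0, 1, 0, 0⟩, ⟨1/2, 1/2, 1/2, 0⟩, ⟨-1/2, 1/4, 0, 1/4⟩])), lattice_mem_rightIdeals⟩ := by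
  obtain ⟨b, hb⟩ := exists_eq_units_smul_of_mem_rightIdeals I.2
  apply Quotient.sound
  exact ⟨b⁻¹, by rw [hb, inv_smul_smul]⟩

/-- Every class of `Cls O₁₃` is the class of `O₁₃`. [cite: Voight2021, Thm. 25.4.1 (D = 13)] -/
theorem classSet_eq (c : ClassSet (Submodule.span ℤ (Set.range ![(⟨1, 0, 0, 0⟩ : ℍ[ℚ,-2,-13]), ⟨0, 1, 0, 0⟩, ⟨1/2, 1/2, 1/2, 0⟩, ⟨-1/2, 1/4, 0, 1/4⟩]))) : c = Quotient.mk (rightClassSetoid (Submodule.span ℤ (Set.range ![(⟨1, 0, 0, 0⟩ : ℍ[ℚ,-2,-13]), ⟨0, 1, 0, 0⟩, ⟨1/2, 1/2, 1/2, 0⟩, ⟨-1/2, 1/4, 0, 1/4⟩]))) ⟨(Submodule.span ℤ (Set.range ![(⟨1, 0, 0, 0⟩ : ℍ[ℚ,-2,-13]), ⟨0, 1, 0, 0⟩, ⟨1/2, 1/2, 1/2, 0⟩, ⟨-1/2, 1/4, 0, 1/4⟩])), lattice_mem_rightIdeals⟩ := by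
  induction c using Quotient.inductionOn with
  | h I => exact classSet_mk_eq I

/-- `Cls O₁₃` has at most one element. [cite: Voight2021, Thm. 25.4.1 (D = 13)] -/
theorem subsingleton_classSet : Subsingleton (ClassSet (Submodule.span ℤ (Set.range ![(⟨1, 0, 0, 0⟩ : ℍ[ℚ,-2,-13]), ⟨0, 1, 0, 0⟩, ⟨1/2, 1/2, 1/2, 0⟩, ⟨-1/2, 1/4, 0, 1/4⟩]))) :=
  ⟨fun a b => by rw [classSet_eq a, classSet_eq b]⟩

/-- **`# Cls O₁₃ = 1`** (Voight Thm. 25.4.1, the case `D = 13`; Exercise 17.10). [cite: Voight2021, Thm. 25.4.1 (D = 13) and Exercise 17.10] -/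
theorem card_classSet : Nat.card (ClassSet (Submodule.span ℤ (Set.range ![(⟨1, 0, 0, 0⟩ : ℍ[ℚ,-2,-13]), ⟨0, 1, 0, 0⟩, ⟨1/2, 1/2, 1/2, 0⟩, ⟨-1/2, 1/4, 0, 1/4⟩]))) = 1 := by
  haveI := subsingleton_classSet
  exact Nat.card_of_subsingleton (Quotient.mk (rightClassSetoid (Submodule.span ℤ (Set.range ![(⟨1, 0, 0, 0⟩ : ℍ[ℚ,-2,-13]), ⟨0, 1, 0, 0⟩, ⟨1/2, 1/2, 1/2, 0⟩, ⟨-1/2, 1/4, 0, 1/4⟩]))) ⟨(Submodule.span ℤ (Set.range ![(⟨1, 0, 0, 0⟩ : ℍ[ℚ,-2,-13]), ⟨0, 1, 0, 0⟩, ⟨1/2, 1/2, 1/2, 0⟩, ⟨-1/2, 1/4, 0, 1/4⟩])), lattice_mem_rightIdeals⟩)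

end Classes

/-! ## §3 The weights and the numerators are class functions; `w = 2`, `Σ 1/w = 1/2` -/

section Weights

/-- **Conjugation by `α` identifies `{x ∈ O_L(αI) : trd x = t, nrd x = n}` with `{x ∈ O_L(I) : trd x = t, nrd x = n}`.**
[cite: Voight2021, Lemma 17.3.3, Lemma 41.2.7] [cite: VignerasLNM800, Ch. V §2 Prop. 2.4] -/
theorem card_traceNormSet_units_smul (α : (ℍ[ℚ,-2,-13])ˣ) (I : Submodule ℤ ℍ[ℚ,-2,-13]) (t n : ℚ) :
    Nat.card (traceNormSet (α • I) t n) = Nat.card (traceNormSet I t n) := by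
  haveI := isQuaternionAlgebra
  have hα : (α : ℍ[ℚ,-2,-13]) = (((α⁻¹)⁻¹ : (ℍ[ℚ,-2,-13])ˣ) : ℍ[ℚ,-2,-13]) := by rw [inv_inv]
  refine Nat.card_congr
    { toFun := fun x => ⟨((α⁻¹ : (ℍ[ℚ,-2,-13])ˣ) : ℍ[ℚ,-2,-13]) * x.1 * α, ?_⟩
      invFun := fun y => ⟨(α : ℍ[ℚ,-2,-13]) * y.1 * ((α⁻¹ : (ℍ[ℚ,-2,-13])ˣ) : ℍ[ℚ,-2,-13]), ?_⟩
      left_inv := fun x => Subtype.ext ?_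
      right_inv := fun y => Subtype.ext ?_ }
  · obtain ⟨hL, ht, hn⟩ := x.2
    refine ⟨conj_mem_leftOrder_of_mem hL, ?_, ?_⟩
    · rw [hα, reducedTrace_units_conj, ht]
    · rw [hα, reducedNorm_units_conj, hn]
  · obtain ⟨hL, ht, hn⟩ := y.2
    exact ⟨conj_mem_leftOrder_smul_of_mem hL, by rw [reducedTrace_units_conj, ht], by rw [reducedNorm_units_conj, hn]⟩
  · show (α : ℍ[ℚ,-2,-13]) * (((α⁻¹ : (ℍ[ℚ,-2,-13])ˣ) : ℍ[ℚ,-2,-13]) * x.1 * α) * ((α⁻¹ : (ℍ[ℚ,-2,-13])ˣ) : ℍ[ℚ,-2,-13]) = x.1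
    rw [← mul_assoc, ← mul_assoc, Units.mul_inv, one_mul, mul_assoc, Units.mul_inv, mul_one]
  · show ((α⁻¹ : (ℍ[ℚ,-2,-13])ˣ) : ℍ[ℚ,-2,-13]) * ((α : ℍ[ℚ,-2,-13]) * y.1 * ((α⁻¹ : (ℍ[ℚ,-2,-13])ˣ) : ℍ[ℚ,-2,-13])) * α = y.1
    rw [← mul_assoc, ← mul_assoc, Units.inv_mul, one_mul, mul_assoc, Units.inv_mul, mul_one]

/-- **Conjugation by `α` identifies `{x ∈ O_L(αI) : nrd x = n}` with `{x ∈ O_L(I) : nrd x = n}`** (the numerators of the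
diagonal Brandt matrix entries, `2w_i T(n)_ii = #{x ∈ O_L(I_i) : nrd x = n}`, are class functions). [cite: Voight2021, Lemma 17.3.3, Lemma 41.2.7] -/
theorem card_normSet_units_smul (α : (ℍ[ℚ,-2,-13])ˣ) (I : Submodule ℤ ℍ[ℚ,-2,-13]) (n : ℚ) :
    Nat.card {x : ℍ[ℚ,-2,-13] // x ∈ leftOrder (α • I) ∧ reducedNorm ℚ ℍ[ℚ,-2,-13] x = n} =
      Nat.card {x : ℍ[ℚ,-2,-13] // x ∈ leftOrder I ∧ reducedNorm ℚ ℍ[ℚ,-2,-13] x = n} := by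
  haveI := isQuaternionAlgebra
  have hα : (α : ℍ[ℚ,-2,-13]) = (((α⁻¹)⁻¹ : (ℍ[ℚ,-2,-13])ˣ) : ℍ[ℚ,-2,-13]) := by rw [inv_inv]
  refine Nat.card_congr
    { toFun := fun x => ⟨((α⁻¹ : (ℍ[ℚ,-2,-13])ˣ) : ℍ[ℚ,-2,-13]) * x.1 * α, ?_⟩
      invFun := fun y => ⟨(α : ℍ[ℚ,-2,-13]) * y.1 * ((α⁻¹ : (ℍ[ℚ,-2,-13])ˣ) : ℍ[ℚ,-2,-13]), ?_⟩
      left_inv := fun x => Subtype.ext ?_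
      right_inv := fun y => Subtype.ext ?_ }
  · obtain ⟨hL, hn⟩ := x.2
    refine ⟨conj_mem_leftOrder_of_mem hL, ?_⟩
    rw [hα, reducedNorm_units_conj, hn]
  · obtain ⟨hL, hn⟩ := y.2
    exact ⟨conj_mem_leftOrder_smul_of_mem hL, by rw [reducedNorm_units_conj, hn]⟩
  · show (α : ℍ[ℚ,-2,-13]) * (((α⁻¹ : (ℍ[ℚ,-2,-13])ˣ) : ℍ[ℚ,-2,-13]) * x.1 * α) * ((α⁻¹ : (ℍ[ℚ,-2,-13])ˣ) : ℍ[ℚ,-2,-13]) = x.1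
    rw [← mul_assoc, ← mul_assoc, Units.mul_inv, one_mul, mul_assoc, Units.mul_inv, mul_one]
  · show ((α⁻¹ : (ℍ[ℚ,-2,-13])ˣ) : ℍ[ℚ,-2,-13]) * ((α : ℍ[ℚ,-2,-13]) * y.1 * ((α⁻¹ : (ℍ[ℚ,-2,-13])ˣ) : ℍ[ℚ,-2,-13])) * α = y.1
    rw [← mul_assoc, ← mul_assoc, Units.inv_mul, one_mul, mul_assoc, Units.inv_mul, mul_one]

/-- The chosen representative of a class of `Cls O₁₃` is a principal ideal `αO₁₃`. [cite: Voight2021, Def. 17.3.1 and Exercise 17.10] -/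
theorem exists_rep_eq_units_smul (c : ClassSet (Submodule.span ℤ (Set.range ![(⟨1, 0, 0, 0⟩ : ℍ[ℚ,-2,-13]), ⟨0, 1, 0, 0⟩, ⟨1/2, 1/2, 1/2, 0⟩, ⟨-1/2, 1/4, 0, 1/4⟩]))) : ∃ α : (ℍ[ℚ,-2,-13])ˣ, c.rep = α • (Submodule.span ℤ (Set.range ![(⟨1, 0, 0, 0⟩ : ℍ[ℚ,-2,-13]), ⟨0, 1, 0, 0⟩, ⟨1/2, 1/2, 1/2, 0⟩, ⟨-1/2, 1/4, 0, 1/4⟩])) :=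
  exists_eq_units_smul_of_mem_rightIdeals c.rep_mem

/-- **The trace–norm numerators do not depend on the class**: `#{x ∈ O_L(I_c) : (trd, nrd) = (t, n)} = #{x ∈ O₁₃ : …}`.
[cite: VignerasLNM800, Ch. V §2 Prop. 2.4] [cite: Voight2021, Lemma 41.2.7] -/
theorem card_traceNormSet_rep (c : ClassSet (Submodule.span ℤ (Set.range ![(⟨1, 0, 0, 0⟩ : ℍ[ℚ,-2,-13]), ⟨0, 1, 0, 0⟩, ⟨1/2, 1/2, 1/2, 0⟩, ⟨-1/2, 1/4, 0, 1/4⟩]))) (t n : ℚ) :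
    Nat.card (traceNormSet c.rep t n) = Nat.card (traceNormSet (Submodule.span ℤ (Set.range ![(⟨1, 0, 0, 0⟩ : ℍ[ℚ,-2,-13]), ⟨0, 1, 0, 0⟩, ⟨1/2, 1/2, 1/2, 0⟩, ⟨-1/2, 1/4, 0, 1/4⟩])) t n) := by
  obtain ⟨α, hα⟩ := exists_rep_eq_units_smul c
  rw [hα, card_traceNormSet_units_smul]

/-- **The norm numerators do not depend on the class**: `#{x ∈ O_L(I_c) : nrd x = n} = #{x ∈ O₁₃ : nrd x = n}`
(`O_L(O₁₃) = O₁₃`). [cite: Voight2021, Lemma 41.2.7] -/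
theorem card_normSet_rep (c : ClassSet (Submodule.span ℤ (Set.range ![(⟨1, 0, 0, 0⟩ : ℍ[ℚ,-2,-13]), ⟨0, 1, 0, 0⟩, ⟨1/2, 1/2, 1/2, 0⟩, ⟨-1/2, 1/4, 0, 1/4⟩]))) (n : ℚ) :
    Nat.card {x : ℍ[ℚ,-2,-13] // x ∈ leftOrder c.rep ∧ reducedNorm ℚ ℍ[ℚ,-2,-13] x = n} =
      Nat.card {x : ℍ[ℚ,-2,-13] // x ∈ (Submodule.span ℤ (Set.range ![(⟨1, 0, 0, 0⟩ : ℍ[ℚ,-2,-13]), ⟨0, 1, 0, 0⟩, ⟨1/2, 1/2, 1/2, 0⟩, ⟨-1/2, 1/4, 0, 1/4⟩])) ∧ reducedNorm ℚ ℍ[ℚ,-2,-13] x = n} := by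
  obtain ⟨α, hα⟩ := exists_rep_eq_units_smul c
  rw [hα, card_normSet_units_smul, leftOrder_lattice]

/-- **Every Brandt weight of `O₁₃` is `w = #O₁₃^×/2 = 1`.** [cite: Voight2021, Thm. 11.5.14 and Lemma 41.2.7] [cite: VignerasLNM800, Ch. V §2 Cor. 2.3] -/
theorem weight_eq_one (c : ClassSet (Submodule.span ℤ (Set.range ![(⟨1, 0, 0, 0⟩ : ℍ[ℚ,-2,-13]), ⟨0, 1, 0, 0⟩, ⟨1/2, 1/2, 1/2, 0⟩, ⟨-1/2, 1/4, 0, 1/4⟩]))) : weight (Submodule.span ℤ (Set.range ![(⟨1, 0, 0, 0⟩ : ℍ[ℚ,-2,-13]), ⟨0, 1, 0, 0⟩, ⟨1/2, 1/2, 1/2, 0⟩, ⟨-1/2, 1/4, 0, 1/4⟩])) c = 1 := by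
  rw [classSet_eq c, weight_mk, leftOrder_lattice, unitIndex_lattice]

/-- **Eichler's mass formula at `D = 13`: `Σ_c 1/w_c = 1 = φ(13)/12`** (one class of weight `1`).
[cite: Voight2021, Thm. 25.1.1] [cite: VignerasLNM800, Ch. V §2 Cor. 2.3] -/
theorem sum_inv_weight_eq [Fintype (ClassSet (Submodule.span ℤ (Set.range ![(⟨1, 0, 0, 0⟩ : ℍ[ℚ,-2,-13]), ⟨0, 1, 0, 0⟩, ⟨1/2, 1/2, 1/2, 0⟩, ⟨-1/2, 1/4, 0, 1/4⟩])))] : ∑ c : ClassSet (Submodule.span ℤ (Set.range ![(⟨1, 0, 0, 0⟩ : ℍ[ℚ,-2,-13]), ⟨0, 1, 0, 0⟩, ⟨1/2, 1/2, 1/2, 0⟩, ⟨-1/2, 1/4, 0, 1/4⟩])), (1 : ℚ) / weight (Submodule.span ℤ (Set.range ![(⟨1, 0, 0, 0⟩ : ℍ[ℚ,-2,-13]), ⟨0, 1, 0, 0⟩, ⟨1/2, 1/2, 1/2, 0⟩, ⟨-1/2, 1/4, 0, 1/4⟩])) c = 1 := by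
  haveI := subsingleton_classSet
  have c₀ : ClassSet (Submodule.span ℤ (Set.range ![(⟨1, 0, 0, 0⟩ : ℍ[ℚ,-2,-13]), ⟨0, 1, 0, 0⟩, ⟨1/2, 1/2, 1/2, 0⟩, ⟨-1/2, 1/4, 0, 1/4⟩])) := Quotient.mk (rightClassSetoid (Submodule.span ℤ (Set.range ![(⟨1, 0, 0, 0⟩ : ℍ[ℚ,-2,-13]), ⟨0, 1, 0, 0⟩, ⟨1/2, 1/2, 1/2, 0⟩, ⟨-1/2, 1/4, 0, 1/4⟩]))) ⟨(Submodule.span ℤ (Set.range ![(⟨1, 0, 0, 0⟩ : ℍ[ℚ,-2,-13]), ⟨0, 1, 0, 0⟩, ⟨1/2, 1/2, 1/2, 0⟩, ⟨-1/2, 1/4, 0, 1/4⟩])), lattice_mem_rightIdeals⟩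
  rw [Fintype.sum_subsingleton _ c₀, weight_eq_one]
  norm_num

end Weights

end Literature.NumberTheory.Automorphic.MaxOrderDiscThirteen
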